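import Summits.ResolutionOfSingularities.ResolutionOfSingularities.Theorems.WeightedInvariantWeightedThesisHypersurfaceChoiceT
import HarnessLib

/-!
# TOWER-INDEXED centre choices — the torus in the STATE (RESHAPE 11 objects)

Route `ResolutionOfSingularities/WeightedInvariant`, crux `Theses.WeightedInvariant.WeightedThesis`
(stmt-ResolutionOfSingularities-0569), line `datum-glued-split`, lead c9, RESHAPE 11 — objects.

RESHAPE 10 (`Theorems/…HypersurfaceChoiceT.lean`) cut the homogeneity obligation down to the TOWER charts
`(H_T)`, but its centre is still a function of the BARE pair `(Y, X)`: a constructor whose centre is defined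
through the torus of the tower (Abramovich–Quek–Schober, arXiv:2507.01232, Thm. 1.1: "the unique
`T`-invariant center … supported along the singular closed ORBIT") cannot even DEFINE it from the bare
pair — the same scheme could a priori end two towers with two tori — and would have to choose a history
by classical choice, after which `(H_T)` confronts it with the charts of a possibly different history.
The cure is to put the history in the state: here the centre is a function of the TOWER.

* `HypersurfacePair.Tower P` — tower DATA ending at the hypersurface pair `P`: either the empty tower at
  `P`, or a tower ending at `P⁻` followed by the global cobordant blow-up of a Rees filtration `R'` on the
  ambient of `P⁻` with the strict transform (and the facts that make the result a hypersurface pair);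
  `Tower.startPair`, `Tower.rank` (number of steps = rank of the acting torus);
* `Tower.IsRun c τ` — `τ` is a run of the tower-indexed centre rule `c`: every step blows up the centre
  `c` prescribes for the prefix, at a prefix whose hypersurface is singular;
* `Tower.IsChart τ j W 𝒢` — `(W, 𝒢)` is a chart of the torus OF `τ`: the trivial `ℤ⁰`-grading of any affine
  open for the empty tower, a `TowerChartStep` (RESHAPE 10: transport to a localisation of the extended Rees
  algebra, bigrading pinned on ring generators) over a chart of the prefix for a step — so the gradings are
  those of the `𝔾ₘ^{rank τ}`-action of THIS tower and of no other;
* `HypersurfaceTowerChoiceDim p e` — a centre for every tower, with `(iii)` regular weighted centre, `(ii')`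
  generic point off the support, `(H_τ)` homogeneity on the charts of the tower, demanded on the runs of the
  rule started at an `e`-dimensional hypersurface and ending at a singular one, and `(T)` well-foundedness
  of "extend the run by the prescribed step" on such runs;
* `HypersurfaceTowerChoiceDim.ofChoiceTDim` — a pair-indexed tower-typed choice (RESHAPE 10) is a
  tower-indexed one (read the centre off the end pair: a run is a `Step`-chain, `IsRun.reachDim`; a chart
  of the tower is a tower chart of the end pair, `IsChart.isTowerChart`); so every earlier door implies
  this one: stmt-0571 ⇒ datum ⇒ strategy ⇒ choice ⇒ `(H)`-ladder ⇒ `(H_T)`-ladder ⇒ tower-indexed ladder;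
* `hyp_isHomogeneous_of_forall_mem` (registered stub of the line) — every ideal is homogeneous for a
  grading one of whose pieces is everything (the empty tower's charts).

The consumer side (`Theorems/…HypersurfaceTowerChoiceTower.lean`) runs Włodarczyk's cobordant tower ON
TOWER DATA and proves `(∀ p prime, ∀ e, Nonempty (HypersurfaceTowerChoiceDim p e)) → (char-p Bergh–Rydh) →
WeightedThesis`. Rung `e = 1` is now Abramovich–Quek–Schober Thm. 1.1 with nothing lost in translation
but language: their `(𝒲 ⊃ 𝒵, T = 𝔾ₘⁿ)` is the end of a run of rank `n` started at a curve on a surface,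
their `T`-invariant centre is a centre homogeneous on the charts of the run, their `𝒲' = B₊` with
`T' = T × 𝔾ₘ` is the extended run, their termination is `(T)`.
-/

noncomputable section

open scoped LaurentPolynomial
open CategoryTheory AlgebraicGeometry TopologicalSpace
open Literature.AlgebraicGeometry.Resolution

set_option linter.dupNamespace false -- mandated namespace of this single-conjunct summit

namespace Summit.ResolutionOfSingularities.ResolutionOfSingularities.Theorems

/-! ## Ideals are homogeneous for a grading with a total piece -/

/-- **Every ideal is homogeneous for a grading one of whose pieces is the whole ring** (registered stub of
line `datum-glued-split`, RESHAPE 11 — the charts of the EMPTY tower carry the trivial `ℤ⁰`-grading): the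
homogeneous components of an element of `I` are the element itself (in the total degree) and `0`.
[folklore] -/
theorem hyp_isHomogeneous_of_forall_mem : ∀ {ι R : Type} [DecidableEq ι] [AddMonoid ι] [CommRing R] (𝒢 : ι → AddSubgroup R) [GradedRing 𝒢] (i₀ : ι), (∀ x : R, x ∈ 𝒢 i₀) → ∀ I : Ideal R, I.IsHomogeneous 𝒢 := by
  intro ι R _ _ _ 𝒢 _ i₀ h I d x hx
  classical
  by_cases hd : d = i₀
  · subst hd
    rw [DirectSum.decompose_of_mem_same 𝒢 (h x)]
    exact hx
  · rw [DirectSum.decompose_of_mem_ne 𝒢 (h x) (Ne.symm hd)]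
    exact I.zero_mem

namespace HypersurfacePair

variable {k : Type} [Field k]

/-! ## Tower data -/

/-- **Tower data ending at a hypersurface pair.** `Tower P`: a cobordant tower whose last pair is `P` —
the empty tower at `P`, or a tower ending at `P⁻` extended by the global cobordant blow-up `B₊ = R'.plus` of
a Rees filtration `R'` on the ambient of `P⁻`, with the strict transform of the hypersurface, together with
the facts (theorems of the route's tower when `R'` is the filtration of a regular weighted centre off the
generic point) that `B₊ → Spec k` is smooth separated quasi-compact and that the strict transform is a
locally principal ideal sheaf with integral subscheme. The STATE of the tower-indexed interface: it carries
the whole history, hence the torus. A type of the line, not a cited statement. [folklore] -/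
inductive Tower : HypersurfacePair k → Type 1
  /-- the empty tower at `P` -/
  | start (P : HypersurfacePair k) : Tower P
  /-- one more cobordant blow-up -/
  | step {P : HypersurfacePair k} (τ : Tower P) (R' : ReesFiltration P.Y)
      (hs : Smooth (R'.πPlus ≫ P.f)) (hsep : IsSeparated (R'.πPlus ≫ P.f))
      (hqc : QuasiCompact (R'.πPlus ≫ P.f))
      (hlp : IsLocallyPrincipal (R'.strictTransformPlus P.X))
      (hint : IsIntegral (R'.strictTransformPlus P.X).subscheme) :
      Tower (P.succ R' hs hsep hqc hlp hint)

namespace Tower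

/-- The pair a tower was STARTED at. [folklore] -/
def startPair : ∀ {P : HypersurfacePair k}, Tower P → HypersurfacePair k
  | P, start _ => P
  | _, step τ _ _ _ _ _ _ => τ.startPair

/-- The number of steps of a tower (the rank of the torus acting on its end). [folklore] -/
def rank : ∀ {P : HypersurfacePair k}, Tower P → ℕ
  | _, start _ => 0
  | _, step τ _ _ _ _ _ _ => τ.rank + 1

/-- `startPair` of the empty tower. [folklore] -/
@[simp] theorem startPair_start (P : HypersurfacePair k) : (start P).startPair = P := rfl

/-- `startPair` is unchanged by a step. [folklore] -/
@[simp] theorem startPair_step {P : HypersurfacePair k} (τ : Tower P) (R' : ReesFiltration P.Y)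
    (hs : Smooth (R'.πPlus ≫ P.f)) (hsep : IsSeparated (R'.πPlus ≫ P.f))
    (hqc : QuasiCompact (R'.πPlus ≫ P.f)) (hlp : IsLocallyPrincipal (R'.strictTransformPlus P.X))
    (hint : IsIntegral (R'.strictTransformPlus P.X).subscheme) :
    (τ.step R' hs hsep hqc hlp hint).startPair = τ.startPair := rfl

/-- `rank` of the empty tower. [folklore] -/
@[simp] theorem rank_start (P : HypersurfacePair k) : (start P).rank = 0 := rfl

/-- `rank` grows by one per step. [folklore] -/
@[simp] theorem rank_step {P : HypersurfacePair k} (τ : Tower P) (R' : ReesFiltration P.Y)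
    (hs : Smooth (R'.πPlus ≫ P.f)) (hsep : IsSeparated (R'.πPlus ≫ P.f))
    (hqc : QuasiCompact (R'.πPlus ≫ P.f)) (hlp : IsLocallyPrincipal (R'.strictTransformPlus P.X))
    (hint : IsIntegral (R'.strictTransformPlus P.X).subscheme) :
    (τ.step R' hs hsep hqc hlp hint).rank = τ.rank + 1 := rfl

/-- **Runs of a tower-indexed centre rule.** `τ.IsRun c`: every step of `τ` blows up the Rees filtration
with the pieces of the centre that `c` prescribes for the prefix tower, at a prefix whose hypersurface is
not regular. [folklore] -/
def IsRun (c : ∀ ⦃P : HypersurfacePair k⦄, Tower P → ReesAlgebraData P.Y) :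
    ∀ {P : HypersurfacePair k}, Tower P → Prop
  | _, start _ => True
  | _, @step _ _ P τ R' _ _ _ _ _ =>
      IsRun c τ ∧ ¬ Scheme.IsRegular P.X.subscheme ∧ R'.ideal = (c τ).piece

/-- The empty tower is a run. [folklore] -/
@[simp] theorem isRun_start (c : ∀ ⦃P : HypersurfacePair k⦄, Tower P → ReesAlgebraData P.Y)
    (P : HypersurfacePair k) : (start P).IsRun c := trivial

/-- Unfolding `IsRun` at a step. [folklore] -/
theorem isRun_step_iff (c : ∀ ⦃P : HypersurfacePair k⦄, Tower P → ReesAlgebraData P.Y)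
    {P : HypersurfacePair k} (τ : Tower P) (R' : ReesFiltration P.Y)
    (hs : Smooth (R'.πPlus ≫ P.f)) (hsep : IsSeparated (R'.πPlus ≫ P.f))
    (hqc : QuasiCompact (R'.πPlus ≫ P.f)) (hlp : IsLocallyPrincipal (R'.strictTransformPlus P.X))
    (hint : IsIntegral (R'.strictTransformPlus P.X).subscheme) :
    (τ.step R' hs hsep hqc hlp hint).IsRun c ↔
      τ.IsRun c ∧ ¬ Scheme.IsRegular P.X.subscheme ∧ R'.ideal = (c τ).piece :=
  Iff.rfl

/-- **Charts of the torus of a tower.** `τ.IsChart j W 𝒢`: the affine open `W` of the end ambient with the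
`ℤʲ`-grading `𝒢` of its sections is a chart of the `𝔾ₘʲ`-torus of THIS tower — for the empty tower `j = 0`
and the grading is trivial, after a step `j = j⁻ + 1` and `(W, 𝒢)` is a `TowerChartStep` (transport to a
localisation of the extended Rees algebra, bigrading pinned on ring generators) over a chart of the prefix.
[folklore] -/
def IsChart : ∀ {P : HypersurfacePair k}, Tower P → ∀ (j : ℕ) (W : P.Y.affineOpens),
    ((Fin j → ℤ) → AddSubgroup Γ(P.Y, W)) → Prop
  | _, start P, j, W, 𝒢 => ∃ _ : j = 0, ∀ (v : Fin j → ℤ) (x : Γ(P.Y, W)), x ∈ 𝒢 v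
  | _, @step _ _ P τ R' _ _ _ _ _, j, W, 𝒢 =>
      ∃ (j' : ℕ) (h : j = j' + 1) (U : P.Y.affineOpens) (𝒢U : (Fin j' → ℤ) → AddSubgroup Γ(P.Y, U)),
        IsChart τ j' U 𝒢U ∧ TowerChartStep U j' 𝒢U R' W (h ▸ 𝒢)

/-- The charts of the empty tower: rank `0`, trivial grading. [folklore] -/
theorem IsChart.start_iff (P : HypersurfacePair k) (j : ℕ) (W : P.Y.affineOpens)
    (𝒢 : (Fin j → ℤ) → AddSubgroup Γ(P.Y, W)) :
    (start P).IsChart j W 𝒢 ↔ ∃ _ : j = 0, ∀ (v : Fin j → ℤ) (x : Γ(P.Y, W)), x ∈ 𝒢 v :=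
  Iff.rfl

/-- Introduction of a chart of the empty tower. [folklore] -/
theorem IsChart.of_start (P : HypersurfacePair k) (W : P.Y.affineOpens)
    (𝒢 : (Fin 0 → ℤ) → AddSubgroup Γ(P.Y, W)) (h𝒢 : ∀ (v : Fin 0 → ℤ) (x : Γ(P.Y, W)), x ∈ 𝒢 v) :
    (start P).IsChart 0 W 𝒢 :=
  ⟨rfl, h𝒢⟩

/-- Introduction of a chart one step up. [folklore] -/
theorem IsChart.of_step {P : HypersurfacePair k} {τ : Tower P} {R' : ReesFiltration P.Y}
    {hs : Smooth (R'.πPlus ≫ P.f)} {hsep : IsSeparated (R'.πPlus ≫ P.f)}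
    {hqc : QuasiCompact (R'.πPlus ≫ P.f)} {hlp : IsLocallyPrincipal (R'.strictTransformPlus P.X)}
    {hint : IsIntegral (R'.strictTransformPlus P.X).subscheme} {j : ℕ} {U : P.Y.affineOpens}
    {𝒢U : (Fin j → ℤ) → AddSubgroup Γ(P.Y, U)} (hU : τ.IsChart j U 𝒢U)
    (W : (R'.plus : Scheme.{0}).affineOpens)
    (𝒢 : (Fin (j + 1) → ℤ) → AddSubgroup Γ((R'.plus : Scheme.{0}), W))
    (hW : TowerChartStep U j 𝒢U R' W 𝒢) :
    (τ.step R' hs hsep hqc hlp hint).IsChart (j + 1) W 𝒢 :=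
  ⟨j, rfl, U, 𝒢U, hU, hW⟩

end Tower

end HypersurfacePair

/-! ## Tower-indexed centre choices in transversal dimension `e` -/

/-- **Tower-indexed hypersurface centre choice in characteristic `p` and transversal dimension `e`** (object
posited by line `datum-glued-split` of crux `WeightedThesis`, RESHAPE 11 — the torus in the STATE): a weighted
centre `centre τ : ReesAlgebraData P.Y` for every cobordant TOWER `τ` ending at a hypersurface pair `P` (so the
centre may be read off the whole history — in particular off the torus of the tower), such that, over every
perfect field of characteristic `p`, for every RUN `τ` of `centre` (each step blew up the prescribed centre of a
singular prefix) STARTED at a pair whose integral hypersurface has dimension `e` and ENDING at a pair whose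
hypersurface is not regular: `(iii)` `centre τ` is a regular weighted centre, `(ii')` the generic point of the
hypersurface is off its support, `(H_τ)` every piece of `centre τ` is homogeneous on every chart `(W, 𝒢)` OF THE
TOWER (`Tower.IsChart`: the `𝔾ₘ^{rank τ}`-gradings of this tower, pinned on ring generators) on which the
hypersurface ideal is homogeneous, and `(T)` the relation "extend a run started in dimension `e` by its
prescribed step" is well-founded. The most permissive of the line's doors: stmt-0571 ⇒ … ⇒ `(H_T)`-ladder ⇒
this (`ofChoiceTDim`). Rung `e = 1` is Abramovich–Quek–Schober arXiv:2507.01232 Thm. 1.1 up to language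
(their `(𝒲 ⊃ 𝒵, 𝔾ₘⁿ)` = the end of a run of rank `n` started at a curve on a smooth surface; their unique
`T`-invariant centre along a singular closed orbit = a centre homogeneous on the charts of the run; their
`𝒲' = B₊`, `T' = T × 𝔾ₘ` = the extended run; their finite termination = `(T)`). EVIDENCE, not a claim. -/
structure HypersurfaceTowerChoiceDim (p e : ℕ) : Type 1 where
  /-- the weighted centre prescribed after the tower `τ`, as a Rees algebra on the end ambient -/
  centre : ∀ ⦃k : Type⦄ [Field k] ⦃P : HypersurfacePair k⦄, HypersurfacePair.Tower P → ReesAlgebraData P.Y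
  /-- `(iii)` [runs from dimension `e` ending singular] the centre is a regular weighted centre -/
  isRegularWeightedCentre_centre : ∀ ⦃k : Type⦄ [Field k] [CharP k p] [PerfectField k]
    ⦃P : HypersurfacePair k⦄ (τ : HypersurfacePair.Tower P), τ.IsRun (centre (k := k)) →
    topologicalKrullDim τ.startPair.X.subscheme = (e : WithBot ℕ∞) →
    ¬ Scheme.IsRegular P.X.subscheme → (centre τ).IsRegularWeightedCentre
  /-- `(ii')` [runs from dimension `e` ending singular, the end hypersurface presented by a closed
  immersion `i`] the generic point of the hypersurface is off the centre -/
  genericPoint_not_mem_support_centre : ∀ ⦃k : Type⦄ [Field k] [CharP k p] [PerfectField k]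
    ⦃P : HypersurfacePair k⦄ (τ : HypersurfacePair.Tower P), τ.IsRun (centre (k := k)) →
    topologicalKrullDim τ.startPair.X.subscheme = (e : WithBot ℕ∞) →
    ∀ ⦃X : Scheme.{0}⦄ (i : X ⟶ P.Y) [IsClosedImmersion i] [IsIntegral X], i.ker = P.X →
    ¬ Scheme.IsRegular X → i (genericPoint X) ∉ (centre τ).support
  /-- `(H_τ)` [runs from dimension `e` ending singular] the centre is homogeneous on every chart of the
  torus OF THE TOWER on which the hypersurface ideal is homogeneous -/
  centre_isHomogeneous_chart : ∀ ⦃k : Type⦄ [Field k] [CharP k p] [PerfectField k]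
    ⦃P : HypersurfacePair k⦄ (τ : HypersurfacePair.Tower P), τ.IsRun (centre (k := k)) →
    topologicalKrullDim τ.startPair.X.subscheme = (e : WithBot ℕ∞) →
    ¬ Scheme.IsRegular P.X.subscheme →
    ∀ ⦃j : ℕ⦄ (W : P.Y.affineOpens) (𝒢 : (Fin j → ℤ) → AddSubgroup Γ(P.Y, W)) [GradedRing 𝒢],
    τ.IsChart j W 𝒢 → (P.X.ideal W).IsHomogeneous 𝒢 →
    ∀ n : ℕ, (((centre τ).piece n).ideal W).IsHomogeneous 𝒢
  /-- `(T)` over every perfect field of characteristic `p`: extending runs started in dimension `e` by their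
  prescribed steps is well-founded — every run of the rule started at an `e`-dimensional hypersurface stops -/
  wellFounded_step : ∀ ⦃k : Type⦄ [Field k] [CharP k p] [PerfectField k],
    WellFounded fun σ' σ : (Σ P : HypersurfacePair k, HypersurfacePair.Tower P) =>
      σ.2.IsRun (centre (k := k)) ∧ topologicalKrullDim σ.2.startPair.X.subscheme = (e : WithBot ℕ∞) ∧
      ¬ Scheme.IsRegular σ.1.X.subscheme ∧
      ∃ (R' : ReesFiltration σ.1.Y) (_ : R'.ideal = (centre σ.2).piece)
        (hs : Smooth (R'.πPlus ≫ σ.1.f)) (hsep : IsSeparated (R'.πPlus ≫ σ.1.f))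
        (hqc : QuasiCompact (R'.πPlus ≫ σ.1.f))
        (hlp : IsLocallyPrincipal (R'.strictTransformPlus σ.1.X))
        (hint : IsIntegral (R'.strictTransformPlus σ.1.X).subscheme),
        σ' = ⟨_, σ.2.step R' hs hsep hqc hlp hint⟩

/-! ## A pair-indexed tower-typed choice is a tower-indexed choice -/

namespace HypersurfacePair.Tower

variable {k : Type} [Field k]

/-- **A run of a pair-indexed rule is a `Step`-chain**: reading a pair-indexed centre rule `c` as the
tower-indexed rule "centre of the end pair", every run from `P₀` to `P` is a chain of tower steps of `c`.
[folklore] -/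
theorem IsRun.reflTransGen
    (c : ∀ ⦃Y : Scheme.{0}⦄, (Y ⟶ Spec (.of k)) → Y.IdealSheafData → ReesAlgebraData Y) :
    ∀ {P : HypersurfacePair k} (τ : Tower P),
      τ.IsRun (fun ⦃P : HypersurfacePair k⦄ (_ : Tower P) => c P.f P.X) →
      Relation.ReflTransGen (fun Q Q' : HypersurfacePair k => Step c Q' Q) τ.startPair P
  | _, start P, _ => Relation.ReflTransGen.refl
  | _, @step _ _ P τ R' hs hsep hqc hlp hint, h => by
    obtain ⟨hτ, hsing, hR'⟩ := h
    exact (IsRun.reflTransGen c τ hτ).tail (Step.intro P hsing R' hR' hs hsep hqc hlp hint)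

/-- **A run of a pair-indexed rule started in dimension `e` ends at a pair reached in transversal dimension
`e`.** [folklore] -/
theorem IsRun.reachDim
    (c : ∀ ⦃Y : Scheme.{0}⦄, (Y ⟶ Spec (.of k)) → Y.IdealSheafData → ReesAlgebraData Y)
    {P : HypersurfacePair k} (τ : Tower P)
    (h : τ.IsRun (fun ⦃P : HypersurfacePair k⦄ (_ : Tower P) => c P.f P.X)) {e : ℕ}
    (he : topologicalKrullDim τ.startPair.X.subscheme = (e : WithBot ℕ∞)) : ReachDim c e P :=
  ⟨τ.startPair, he, IsRun.reflTransGen c τ h⟩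

/-- **A chart of a run of a pair-indexed rule is a tower chart of its end pair** (RESHAPE 10's
`IsTowerChart`): by recursion along the tower. [folklore] -/
theorem IsChart.isTowerChart
    (c : ∀ ⦃Y : Scheme.{0}⦄, (Y ⟶ Spec (.of k)) → Y.IdealSheafData → ReesAlgebraData Y) :
    ∀ {P : HypersurfacePair k} (τ : Tower P),
      τ.IsRun (fun ⦃P : HypersurfacePair k⦄ (_ : Tower P) => c P.f P.X) →
      ∀ {j : ℕ} (W : P.Y.affineOpens) (𝒢 : (Fin j → ℤ) → AddSubgroup Γ(P.Y, W)),
        τ.IsChart j W 𝒢 → IsTowerChart c P j W 𝒢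
  | _, start P, _, j, W, 𝒢, h => by
    obtain ⟨hj, h𝒢⟩ := h
    subst hj
    exact IsTowerChart.start P W 𝒢 h𝒢
  | _, @step _ _ P τ R' hs hsep hqc hlp hint, hrun, j, W, 𝒢, h => by
    obtain ⟨hτ, hsing, hR'⟩ := hrun
    obtain ⟨j', hj, U, 𝒢U, hU, hW⟩ := h
    subst hj
    exact IsTowerChart.step (IsChart.isTowerChart c τ hτ U 𝒢U hU) hsing R' hR' hs hsep hqc hlp hint
      W 𝒢 hW

end HypersurfacePair.Tower

/-- `(ii')` of a pair-indexed tower-typed choice, for a hypersurface presented by ANY closed immersion with the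
right kernel (the form the tower-indexed interface uses). [folklore] -/
theorem HypersurfaceCentreChoiceTDim.genericPoint_not_mem_support_centre' {p e : ℕ}
    (C : HypersurfaceCentreChoiceTDim p e) {k : Type} [Field k] [CharP k p] [PerfectField k]
    (P : HypersurfacePair k)
    (hreach : HypersurfacePair.ReachDim
      (fun ⦃Y : Scheme.{0}⦄ (f : Y ⟶ Spec (.of k)) X => C.centre f X) e P)
    {X : Scheme.{0}} (i : X ⟶ P.Y) [IsClosedImmersion i] [IsIntegral X] (hi : i.ker = P.X)
    (hsing : ¬ Scheme.IsRegular X) : i (genericPoint X) ∉ (C.centre P.f P.X).support := by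
  obtain ⟨Y, f, I, hI, hIi⟩ := P
  dsimp only at hi hreach i ⊢
  subst hi
  exact C.genericPoint_not_mem_support_centre f i hI hreach hsing

namespace HypersurfaceTowerChoiceDim

variable {p e : ℕ}

/-- **Every pair-indexed tower-typed choice (RESHAPE 10) is a tower-indexed choice** (read the centre off the
end pair): a run is a `Step`-chain from an `e`-dimensional start (`IsRun.reachDim`), a chart of the tower is a
tower chart of the end pair (`IsChart.isTowerChart`), and `(T)` restricts along `σ ↦ σ.1`. [folklore] -/
def ofChoiceTDim (C : HypersurfaceCentreChoiceTDim p e) : HypersurfaceTowerChoiceDim p e where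
  centre := fun k _ P _ => C.centre P.f P.X
  isRegularWeightedCentre_centre := fun k _ _ _ P τ hrun he hsing =>
    C.isRegularWeightedCentre_centre P (HypersurfacePair.Tower.IsRun.reachDim _ τ hrun he) hsing
  genericPoint_not_mem_support_centre := fun k _ _ _ P τ hrun he X i _ _ hi hsing =>
    C.genericPoint_not_mem_support_centre' P (HypersurfacePair.Tower.IsRun.reachDim _ τ hrun he) i hi hsing
  centre_isHomogeneous_chart := fun k _ _ _ P τ hrun he hsing j W 𝒢 _ hW hXhom n =>
    C.centre_isHomogeneous_towerChart P (HypersurfacePair.Tower.IsRun.reachDim _ τ hrun he) hsing W 𝒢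
      (HypersurfacePair.Tower.IsChart.isTowerChart _ τ hrun W 𝒢 hW) hXhom n
  wellFounded_step := fun k _ _ _ => by
    refine Subrelation.wf ?_ (InvImage.wf (fun σ : (Σ P : HypersurfacePair k, HypersurfacePair.Tower P) => σ.1)
      (C.wellFounded_step (k := k)))
    rintro σ' ⟨P, τ⟩ ⟨hrun, he, hsing, R', hR', hs, hsep, hqc, hlp, hint, rfl⟩
    exact ⟨HypersurfacePair.Tower.IsRun.reachDim _ τ hrun he,
      HypersurfacePair.Step.intro P hsing R' hR' hs hsep hqc hlp hint⟩

end HypersurfaceTowerChoiceDim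

end Summit.ResolutionOfSingularities.ResolutionOfSingularities.Theorems

end
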